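import Literature.NumberTheory.Rogawski1990.ArchCentralLimitChamberReduction   -- ★ p843009 (this seat): the (B-2) socket shape `ArchCentralLimitFormulaRankTwo.of_chamberExtensions`, `isOpen_chamber`
import Literature.NumberTheory.Automorphic.ArchTorusOrbitalWeyl              -- ★ (V-Weyl): `integral_comp_conj_circleDiagonal_comp_perm` (sign-compatible relabellings are Weyl moves of `G_w`) — ED. 2
import HarnessLib

/-!
# `W_K` TRANSPORT OF CORNER EXTENSIONS: the compact Weyl reflection carries a chamber's `C³` corner extension of `F_Θ = ρ′Δ·Φ_Θ` to the reflected chamber, value preserved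
# (Rogawski 1990 §8.4 p. 126; the N1 assembly skeleton, step (B-3) — halves the (A6) sockets of ★ `ArchCentralLimitFormulaRankTwo.of_chamberExtensions`)

Topic `NumberTheory/Rogawski1990`; namespace `Literature.NumberTheory.Rogawski1990`.  THEOREMS ONLY (no `def`, no instance, no notation, no axiom, no named fact, no `sorry`).
Cell `pub/hodgecm-mathlib`, ENGINE T1 (crux H413 = `stmt-HodgeConjecture-24833`); ROAD-Sd, «SdArch» ED. 3's ONE open stub N1 = `stub_ArchCentralLimitU21` (ROAD A, owner F0P3a-p05 (g13),
«=» on (B-2)∕(B-3) 08:54:01Z); the N1 ASSEMBLY SKELETON (α1), F0P3a-p02 (g12), LEAD WORD T9-8 (D); census a4f70f9f §1 (B-3).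

THE MECHANISM.  ★ p843009 reduces the letter to SIX sockets, one per chamber `C_σ = {θ | θ(σ0) < θ(σ1) < θ(σ2)}`: an open `U ∋ 0`, a `C³`-on-`U` function `H` agreeing with `Fz ∘ chart` on `U ∩ C_σ`,
and the 8-ray corner value `Λ₈^∠[H](0) = ℓ`.  Let `P ∈ S₃` act on angles by relabelling, `θ ↦ θ ∘ P` (so `θ ∘ P ∈ C_σ ↔ θ ∈ C_{P σ}`).  §1 FORMAL SKEWNESS (any `H`, no smoothness): for each
transposition `P` the eight rays `v_ε` relabel as `v_ε ∘ P = v_{ε′}` with `s_{ε′} = −s_ε` (`ω = ∏_{i<j}(∂_i − ∂_j)` is `S₃`-skew), hence `Σ_ε s_ε (d∕ds)³|₀ H((s·v_ε) ∘ P) = −Σ_ε s_ε (d∕ds)³|₀ H(s·v_ε)` —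
p06's COLLAPSE ★ `tendsto_lambda8_rhoWeylDelta_mul_comp_perm` read in the angle chart at the corner.  §2 `ρ′Δ = V(z)∕(z₀z₁z₂)` is skew under every transposition (field identity in the letter's
tokens).  §3 **SOCKET TRANSPORT** `exists_chamberExtension_comp_perm`: if `Fz ∘ chart` is `P`-SKEW on the regular angles (`Fz(ζe^{i(θ∘P)}) = −Fz(ζe^{iθ})`) and §1 holds for `P`, a socket for `C_σ`
with value `ℓ` yields the socket `(P⁻¹U, −H ∘ P)` for `C_{Pσ}` with the SAME value `ℓ`.  §4 for the letter's `Fz = ρ′Δ·Φ`: `P`-skewness follows from `P`-EVENNESS of the orbital function `Φ`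
(`Φ(ζe^{i(θ∘P)}) = Φ(ζe^{iθ})`), which holds exactly for the COMPACT transposition `P = W_K` (the block Weyl element of `U(σ_w diag α)(ℂ)` lies in the group iff `e_ie_j > 0`; ★ (A2′)
`blockRot_mem_archLocal` ∕ (H1), A-p14) — so ROAD A owes corner extensions for HALF the chambers: `{D⁺, D⁻, S⁺}` (the compact double-chambers share one `H` trivially; `S⁻ = W_K S⁺`).
HONEST LABEL: HC_CM is proved only modulo the printed citations until rung 0 closes; bookkeeping for the printed-hard letter N1, pays nothing by itself.

## References
* [Rogawski1990] J. D. Rogawski, *Automorphic Representations of Unitary Groups in Three Variables*, Ann. of Math. Stud. 123 (1990), §8.4 pp. 126–127.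
* [Varadarajan1989] V. S. Varadarajan, *An Introduction to Harmonic Analysis on Semisimple Lie Groups* (1989), §6.4.
-/

set_option autoImplicit false

noncomputable section

open Filter Topology Set Function

namespace Literature.NumberTheory.Rogawski1990

/-! ## §0 Chambers under relabelling -/

section Chambers

/-- A chamber point is regular: `θ(σ0) < θ(σ1) < θ(σ2) ⇒ θ` injective (★ `setOf_injective_eq_iUnion_chamber`). [cite: Rogawski1990, §8.4 p. 126] -/
theorem injective_of_mem_chamber {σ : Equiv.Perm (Fin 3)} {θ : Fin 3 → ℝ} (h : θ (σ 0) < θ (σ 1) ∧ θ (σ 1) < θ (σ 2)) : Injective θ := by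
  have hmem : θ ∈ ⋃ τ : Equiv.Perm (Fin 3), {θ : Fin 3 → ℝ | θ (τ 0) < θ (τ 1) ∧ θ (τ 1) < θ (τ 2)} := mem_iUnion.2 ⟨σ, h⟩
  rw [← setOf_injective_eq_iUnion_chamber] at hmem
  exact hmem

/-- **Relabelling permutes the chambers**: `θ ∘ P ∈ C_σ ↔ θ ∈ C_{P σ}`. [cite: Rogawski1990, §8.4 p. 126] -/
theorem comp_perm_mem_chamber_iff (P σ : Equiv.Perm (Fin 3)) (θ : Fin 3 → ℝ) :
    (θ ∘ ⇑P) ∈ {θ : Fin 3 → ℝ | θ (σ 0) < θ (σ 1) ∧ θ (σ 1) < θ (σ 2)} ↔ θ ∈ {θ : Fin 3 → ℝ | θ ((P * σ) 0) < θ ((P * σ) 1) ∧ θ ((P * σ) 1) < θ ((P * σ) 2)} := by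
  simp only [mem_setOf_eq, comp_apply, Equiv.Perm.mul_apply]

end Chambers

/-! ## §1 Formal skewness of the 8-ray corner functional under the three transpositions (any `H`, no smoothness) -/

section Skew

/-- **Reindexing engine**: if a bijection `e` of the eight labels flips the sign weight and relabels the rays composed with `P` (`(s·v_ε) ∘ P = s·v_{e ε}`), then
`Σ_ε s_ε (d∕ds)³|₀ H((s·v_ε) ∘ P) = −Σ_ε s_ε (d∕ds)³|₀ H(s·v_ε)`. [cite: Rogawski1990, §8.4 p. 126] -/
theorem sum_sign_iteratedDeriv_ray_comp_perm_eq_neg (H : (Fin 3 → ℝ) → ℂ) (P : Equiv.Perm (Fin 3)) (e : (Fin 3 → Bool) ≃ (Fin 3 → Bool))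
    (hsign : ∀ ε : Fin 3 → Bool, ((((if (e ε) 0 then (1 : ℝ) else -1) * (if (e ε) 1 then (1 : ℝ) else -1) * (if (e ε) 2 then (1 : ℝ) else -1) : ℝ)) : ℂ) = -((((if ε 0 then (1 : ℝ) else -1) * (if ε 1 then (1 : ℝ) else -1) * (if ε 2 then (1 : ℝ) else -1) : ℝ)) : ℂ))
    (hvec : ∀ (ε : Fin 3 → Bool) (s : ℝ), (s • ![(if ε 0 then (1 : ℝ) else -1) + (if ε 1 then (1 : ℝ) else -1), -(if ε 0 then (1 : ℝ) else -1) + (if ε 2 then (1 : ℝ) else -1), -(if ε 1 then (1 : ℝ) else -1) - (if ε 2 then (1 : ℝ) else -1)]) ∘ ⇑P = s • ![(if (e ε) 0 then (1 : ℝ) else -1) + (if (e ε) 1 then (1 : ℝ) else -1), -(if (e ε) 0 then (1 : ℝ) else -1) + (if (e ε) 2 then (1 : ℝ) else -1), -(if (e ε) 1 then (1 : ℝ) else -1) - (if (e ε) 2 then (1 : ℝ) else -1)]) :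
    ∑ ε : Fin 3 → Bool, ((((if ε 0 then (1 : ℝ) else -1) * (if ε 1 then (1 : ℝ) else -1) * (if ε 2 then (1 : ℝ) else -1) : ℝ)) : ℂ) * iteratedDeriv 3 (fun s : ℝ => H ((s • ![(if ε 0 then (1 : ℝ) else -1) + (if ε 1 then (1 : ℝ) else -1), -(if ε 0 then (1 : ℝ) else -1) + (if ε 2 then (1 : ℝ) else -1), -(if ε 1 then (1 : ℝ) else -1) - (if ε 2 then (1 : ℝ) else -1)]) ∘ ⇑P)) 0 =
      -(∑ ε : Fin 3 → Bool, ((((if ε 0 then (1 : ℝ) else -1) * (if ε 1 then (1 : ℝ) else -1) * (if ε 2 then (1 : ℝ) else -1) : ℝ)) : ℂ) * iteratedDeriv 3 (fun s : ℝ => H (s • ![(if ε 0 then (1 : ℝ) else -1) + (if ε 1 then (1 : ℝ) else -1), -(if ε 0 then (1 : ℝ) else -1) + (if ε 2 then (1 : ℝ) else -1), -(if ε 1 then (1 : ℝ) else -1) - (if ε 2 then (1 : ℝ) else -1)])) 0) := by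
  have hterm : ∀ ε : Fin 3 → Bool, ((((if ε 0 then (1 : ℝ) else -1) * (if ε 1 then (1 : ℝ) else -1) * (if ε 2 then (1 : ℝ) else -1) : ℝ)) : ℂ) * iteratedDeriv 3 (fun s : ℝ => H ((s • ![(if ε 0 then (1 : ℝ) else -1) + (if ε 1 then (1 : ℝ) else -1), -(if ε 0 then (1 : ℝ) else -1) + (if ε 2 then (1 : ℝ) else -1), -(if ε 1 then (1 : ℝ) else -1) - (if ε 2 then (1 : ℝ) else -1)]) ∘ ⇑P)) 0 =
      -(((((if (e ε) 0 then (1 : ℝ) else -1) * (if (e ε) 1 then (1 : ℝ) else -1) * (if (e ε) 2 then (1 : ℝ) else -1) : ℝ)) : ℂ) * iteratedDeriv 3 (fun s : ℝ => H (s • ![(if (e ε) 0 then (1 : ℝ) else -1) + (if (e ε) 1 then (1 : ℝ) else -1), -(if (e ε) 0 then (1 : ℝ) else -1) + (if (e ε) 2 then (1 : ℝ) else -1), -(if (e ε) 1 then (1 : ℝ) else -1) - (if (e ε) 2 then (1 : ℝ) else -1)])) 0) := by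
    intro ε
    rw [hsign ε, neg_mul, neg_neg]
    exact congrArg (fun f : ℝ → ℂ => ((((if ε 0 then (1 : ℝ) else -1) * (if ε 1 then (1 : ℝ) else -1) * (if ε 2 then (1 : ℝ) else -1) : ℝ)) : ℂ) * iteratedDeriv 3 f 0) (funext fun s => by rw [hvec ε s])
  rw [Finset.sum_congr rfl fun ε _ => hterm ε, Finset.sum_neg_distrib]
  exact congrArg Neg.neg (Equiv.sum_comp e (fun ε : Fin 3 → Bool => ((((if ε 0 then (1 : ℝ) else -1) * (if ε 1 then (1 : ℝ) else -1) * (if ε 2 then (1 : ℝ) else -1) : ℝ)) : ℂ) * iteratedDeriv 3 (fun s : ℝ => H (s • ![(if ε 0 then (1 : ℝ) else -1) + (if ε 1 then (1 : ℝ) else -1), -(if ε 0 then (1 : ℝ) else -1) + (if ε 2 then (1 : ℝ) else -1), -(if ε 1 then (1 : ℝ) else -1) - (if ε 2 then (1 : ℝ) else -1)])) 0))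

/-- **Skewness under the transposition `(0 1)`**: `Σ_ε s_ε (d∕ds)³|₀ H((s·v_ε) ∘ swap 0 1) = −Σ_ε s_ε (d∕ds)³|₀ H(s·v_ε)` (relabel `ε ↦ (¬ε₀, ε₂, ε₁)`). [cite: Rogawski1990, §8.4 p. 126] -/
theorem sum_sign_iteratedDeriv_ray_comp_swap01_eq_neg (H : (Fin 3 → ℝ) → ℂ) :
    ∑ ε : Fin 3 → Bool, ((((if ε 0 then (1 : ℝ) else -1) * (if ε 1 then (1 : ℝ) else -1) * (if ε 2 then (1 : ℝ) else -1) : ℝ)) : ℂ) * iteratedDeriv 3 (fun s : ℝ => H ((s • ![(if ε 0 then (1 : ℝ) else -1) + (if ε 1 then (1 : ℝ) else -1), -(if ε 0 then (1 : ℝ) else -1) + (if ε 2 then (1 : ℝ) else -1), -(if ε 1 then (1 : ℝ) else -1) - (if ε 2 then (1 : ℝ) else -1)]) ∘ ⇑(Equiv.swap (0 : Fin 3) 1))) 0 =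
      -(∑ ε : Fin 3 → Bool, ((((if ε 0 then (1 : ℝ) else -1) * (if ε 1 then (1 : ℝ) else -1) * (if ε 2 then (1 : ℝ) else -1) : ℝ)) : ℂ) * iteratedDeriv 3 (fun s : ℝ => H (s • ![(if ε 0 then (1 : ℝ) else -1) + (if ε 1 then (1 : ℝ) else -1), -(if ε 0 then (1 : ℝ) else -1) + (if ε 2 then (1 : ℝ) else -1), -(if ε 1 then (1 : ℝ) else -1) - (if ε 2 then (1 : ℝ) else -1)])) 0) := by
  have hinv : Function.Involutive (fun ε : Fin 3 → Bool => (![!(ε 0), ε 2, ε 1] : Fin 3 → Bool)) := by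
    intro ε; funext k; fin_cases k <;> simp
  refine sum_sign_iteratedDeriv_ray_comp_perm_eq_neg H _ hinv.toPerm (fun ε => ?_) (fun ε s => ?_)
  · simp only [Function.Involutive.coe_toPerm, Matrix.cons_val_zero, Matrix.cons_val_one, Matrix.cons_val_two, Matrix.head_cons, Matrix.tail_cons]
    rcases Bool.eq_false_or_eq_true (ε 0) with h0 | h0 <;> rcases Bool.eq_false_or_eq_true (ε 1) with h1 | h1 <;>
      rcases Bool.eq_false_or_eq_true (ε 2) with h2 | h2 <;> simp [h0, h1, h2]
  · funext k
    simp only [Function.Involutive.coe_toPerm, comp_apply, Pi.smul_apply, smul_eq_mul]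
    rcases Bool.eq_false_or_eq_true (ε 0) with h0 | h0 <;> rcases Bool.eq_false_or_eq_true (ε 1) with h1 | h1 <;>
      rcases Bool.eq_false_or_eq_true (ε 2) with h2 | h2 <;> fin_cases k <;> simp [h0, h1, h2, Equiv.swap_apply_def]

/-- **Skewness under the transposition `(1 2)`** (relabel `ε ↦ (ε₁, ε₀, ¬ε₂)`). [cite: Rogawski1990, §8.4 p. 126] -/
theorem sum_sign_iteratedDeriv_ray_comp_swap12_eq_neg (H : (Fin 3 → ℝ) → ℂ) :
    ∑ ε : Fin 3 → Bool, ((((if ε 0 then (1 : ℝ) else -1) * (if ε 1 then (1 : ℝ) else -1) * (if ε 2 then (1 : ℝ) else -1) : ℝ)) : ℂ) * iteratedDeriv 3 (fun s : ℝ => H ((s • ![(if ε 0 then (1 : ℝ) else -1) + (if ε 1 then (1 : ℝ) else -1), -(if ε 0 then (1 : ℝ) else -1) + (if ε 2 then (1 : ℝ) else -1), -(if ε 1 then (1 : ℝ) else -1) - (if ε 2 then (1 : ℝ) else -1)]) ∘ ⇑(Equiv.swap (1 : Fin 3) 2))) 0 =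
      -(∑ ε : Fin 3 → Bool, ((((if ε 0 then (1 : ℝ) else -1) * (if ε 1 then (1 : ℝ) else -1) * (if ε 2 then (1 : ℝ) else -1) : ℝ)) : ℂ) * iteratedDeriv 3 (fun s : ℝ => H (s • ![(if ε 0 then (1 : ℝ) else -1) + (if ε 1 then (1 : ℝ) else -1), -(if ε 0 then (1 : ℝ) else -1) + (if ε 2 then (1 : ℝ) else -1), -(if ε 1 then (1 : ℝ) else -1) - (if ε 2 then (1 : ℝ) else -1)])) 0) := by
  have hinv : Function.Involutive (fun ε : Fin 3 → Bool => (![ε 1, ε 0, !(ε 2)] : Fin 3 → Bool)) := by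
    intro ε; funext k; fin_cases k <;> simp
  refine sum_sign_iteratedDeriv_ray_comp_perm_eq_neg H _ hinv.toPerm (fun ε => ?_) (fun ε s => ?_)
  · simp only [Function.Involutive.coe_toPerm, Matrix.cons_val_zero, Matrix.cons_val_one, Matrix.cons_val_two, Matrix.head_cons, Matrix.tail_cons]
    rcases Bool.eq_false_or_eq_true (ε 0) with h0 | h0 <;> rcases Bool.eq_false_or_eq_true (ε 1) with h1 | h1 <;>
      rcases Bool.eq_false_or_eq_true (ε 2) with h2 | h2 <;> simp [h0, h1, h2]
  · funext k
    simp only [Function.Involutive.coe_toPerm, comp_apply, Pi.smul_apply, smul_eq_mul]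
    rcases Bool.eq_false_or_eq_true (ε 0) with h0 | h0 <;> rcases Bool.eq_false_or_eq_true (ε 1) with h1 | h1 <;>
      rcases Bool.eq_false_or_eq_true (ε 2) with h2 | h2 <;> fin_cases k <;> simp [h0, h1, h2, Equiv.swap_apply_def] <;> norm_num

/-- **Skewness under the transposition `(0 2)`** (relabel `ε ↦ (¬ε₂, ¬ε₁, ¬ε₀)`). [cite: Rogawski1990, §8.4 p. 126] -/
theorem sum_sign_iteratedDeriv_ray_comp_swap02_eq_neg (H : (Fin 3 → ℝ) → ℂ) :
    ∑ ε : Fin 3 → Bool, ((((if ε 0 then (1 : ℝ) else -1) * (if ε 1 then (1 : ℝ) else -1) * (if ε 2 then (1 : ℝ) else -1) : ℝ)) : ℂ) * iteratedDeriv 3 (fun s : ℝ => H ((s • ![(if ε 0 then (1 : ℝ) else -1) + (if ε 1 then (1 : ℝ) else -1), -(if ε 0 then (1 : ℝ) else -1) + (if ε 2 then (1 : ℝ) else -1), -(if ε 1 then (1 : ℝ) else -1) - (if ε 2 then (1 : ℝ) else -1)]) ∘ ⇑(Equiv.swap (0 : Fin 3) 2))) 0 =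
      -(∑ ε : Fin 3 → Bool, ((((if ε 0 then (1 : ℝ) else -1) * (if ε 1 then (1 : ℝ) else -1) * (if ε 2 then (1 : ℝ) else -1) : ℝ)) : ℂ) * iteratedDeriv 3 (fun s : ℝ => H (s • ![(if ε 0 then (1 : ℝ) else -1) + (if ε 1 then (1 : ℝ) else -1), -(if ε 0 then (1 : ℝ) else -1) + (if ε 2 then (1 : ℝ) else -1), -(if ε 1 then (1 : ℝ) else -1) - (if ε 2 then (1 : ℝ) else -1)])) 0) := by
  have hinv : Function.Involutive (fun ε : Fin 3 → Bool => (![!(ε 2), !(ε 1), !(ε 0)] : Fin 3 → Bool)) := by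
    intro ε; funext k; fin_cases k <;> simp
  refine sum_sign_iteratedDeriv_ray_comp_perm_eq_neg H _ hinv.toPerm (fun ε => ?_) (fun ε s => ?_)
  · simp only [Function.Involutive.coe_toPerm, Matrix.cons_val_zero, Matrix.cons_val_one, Matrix.cons_val_two, Matrix.head_cons, Matrix.tail_cons]
    rcases Bool.eq_false_or_eq_true (ε 0) with h0 | h0 <;> rcases Bool.eq_false_or_eq_true (ε 1) with h1 | h1 <;>
      rcases Bool.eq_false_or_eq_true (ε 2) with h2 | h2 <;> simp [h0, h1, h2]
  · funext k
    simp only [Function.Involutive.coe_toPerm, comp_apply, Pi.smul_apply, smul_eq_mul]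
    rcases Bool.eq_false_or_eq_true (ε 0) with h0 | h0 <;> rcases Bool.eq_false_or_eq_true (ε 1) with h1 | h1 <;>
      rcases Bool.eq_false_or_eq_true (ε 2) with h2 | h2 <;> fin_cases k <;> simp [h0, h1, h2, Equiv.swap_apply_def] <;> norm_num

end Skew

/-! ## §2 `ρ′Δ = V(z)∕(z₀z₁z₂)` is skew under the three transpositions (field identities in the letter's tokens) -/

section RhoWeylDelta

/-- `ρ′Δ` under `(0 1)`: `x₁x₂⁻¹(1−x₀x₁⁻¹)(1−x₂x₀⁻¹)(1−x₂x₁⁻¹) = −[x₀x₂⁻¹(1−x₁x₀⁻¹)(1−x₂x₁⁻¹)(1−x₂x₀⁻¹)]` for non-zero `x₀, x₁, x₂`. [cite: Rogawski1990, §8.4 p. 126] -/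
theorem rhoWeylDelta_swap01 (x0 x1 x2 : ℂ) (h0 : x0 ≠ 0) (h1 : x1 ≠ 0) (h2 : x2 ≠ 0) :
    (x1 * x2⁻¹) * ((1 - x0 * x1⁻¹) * (1 - x2 * x0⁻¹) * (1 - x2 * x1⁻¹)) = -((x0 * x2⁻¹) * ((1 - x1 * x0⁻¹) * (1 - x2 * x1⁻¹) * (1 - x2 * x0⁻¹))) := by
  field_simp
  ring

/-- `ρ′Δ` under `(1 2)`. [cite: Rogawski1990, §8.4 p. 126] -/
theorem rhoWeylDelta_swap12 (x0 x1 x2 : ℂ) (h0 : x0 ≠ 0) (h1 : x1 ≠ 0) (h2 : x2 ≠ 0) :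
    (x0 * x1⁻¹) * ((1 - x2 * x0⁻¹) * (1 - x1 * x2⁻¹) * (1 - x1 * x0⁻¹)) = -((x0 * x2⁻¹) * ((1 - x1 * x0⁻¹) * (1 - x2 * x1⁻¹) * (1 - x2 * x0⁻¹))) := by
  field_simp
  ring

/-- `ρ′Δ` under `(0 2)`. [cite: Rogawski1990, §8.4 p. 126] -/
theorem rhoWeylDelta_swap02 (x0 x1 x2 : ℂ) (h0 : x0 ≠ 0) (h1 : x1 ≠ 0) (h2 : x2 ≠ 0) :
    (x2 * x0⁻¹) * ((1 - x1 * x2⁻¹) * (1 - x0 * x1⁻¹) * (1 - x0 * x2⁻¹)) = -((x0 * x2⁻¹) * ((1 - x1 * x0⁻¹) * (1 - x2 * x1⁻¹) * (1 - x2 * x0⁻¹))) := by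
  field_simp
  ring

end RhoWeylDelta

/-! ## §3 SOCKET TRANSPORT along a transposition under which `Fz ∘ chart` is skew -/

section Transport

/-- **(B-3) SOCKET TRANSPORT.**  Let `P ∈ S₃` satisfy the formal skewness of §1 (`hskew`, = ★ `sum_sign_iteratedDeriv_ray_comp_swap{01,12,02}_eq_neg` for the three transpositions) and let
`Fz ∘ chart` be `P`-SKEW on the regular angles (`hanti`).  Then a corner-extension socket of ★ `ArchCentralLimitFormulaRankTwo.of_chamberExtensions` for the chamber `C_σ` with value `ℓ`
(open `U ∋ 0`, `H` of class `C³` on `U`, `H = Fz ∘ chart` on `U ∩ C_σ`, `Λ₈^∠[H](0) = ℓ`) yields one for the RELABELLED chamber `C_{Pσ}` with the SAME value: `U′ = {θ | θ ∘ P ∈ U}`,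
`H′ = −H(· ∘ P)` (the two signs — skewness of `Fz`, skewness of `ω` — cancel).  With `P = W_K` (the compact transposition) this is the `S⁺ ↦ S⁻` transport. [cite: Rogawski1990, §8.4 p. 126] -/
theorem exists_chamberExtension_comp_perm (Fz : (Fin 3 → Circle) → ℂ) (ζ : Circle) (σ P : Equiv.Perm (Fin 3)) (ℓ : ℂ)
    (hskew : ∀ H : (Fin 3 → ℝ) → ℂ,
      ∑ ε : Fin 3 → Bool, ((((if ε 0 then (1 : ℝ) else -1) * (if ε 1 then (1 : ℝ) else -1) * (if ε 2 then (1 : ℝ) else -1) : ℝ)) : ℂ) * iteratedDeriv 3 (fun s : ℝ => H ((s • ![(if ε 0 then (1 : ℝ) else -1) + (if ε 1 then (1 : ℝ) else -1), -(if ε 0 then (1 : ℝ) else -1) + (if ε 2 then (1 : ℝ) else -1), -(if ε 1 then (1 : ℝ) else -1) - (if ε 2 then (1 : ℝ) else -1)]) ∘ ⇑P)) 0 =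
        -(∑ ε : Fin 3 → Bool, ((((if ε 0 then (1 : ℝ) else -1) * (if ε 1 then (1 : ℝ) else -1) * (if ε 2 then (1 : ℝ) else -1) : ℝ)) : ℂ) * iteratedDeriv 3 (fun s : ℝ => H (s • ![(if ε 0 then (1 : ℝ) else -1) + (if ε 1 then (1 : ℝ) else -1), -(if ε 0 then (1 : ℝ) else -1) + (if ε 2 then (1 : ℝ) else -1), -(if ε 1 then (1 : ℝ) else -1) - (if ε 2 then (1 : ℝ) else -1)])) 0))
    (hanti : ∀ θ : Fin 3 → ℝ, Injective θ → Fz (fun k : Fin 3 => ζ * Circle.exp ((θ ∘ ⇑P) k)) = -Fz (fun k : Fin 3 => ζ * Circle.exp (θ k)))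
    (h : ∃ (U : Set (Fin 3 → ℝ)) (H : (Fin 3 → ℝ) → ℂ), IsOpen U ∧ (0 : Fin 3 → ℝ) ∈ U ∧ ContDiffOn ℝ 3 H U ∧
        (∀ θ ∈ U, θ (σ 0) < θ (σ 1) ∧ θ (σ 1) < θ (σ 2) → H θ = Fz (fun k : Fin 3 => ζ * Circle.exp (θ k))) ∧
        (1 / 48 : ℂ) * ∑ ε : Fin 3 → Bool, ((((if ε 0 then (1 : ℝ) else -1) * (if ε 1 then (1 : ℝ) else -1) * (if ε 2 then (1 : ℝ) else -1) : ℝ)) : ℂ) *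
          iteratedDeriv 3 (fun s : ℝ => H (s • ![(if ε 0 then (1 : ℝ) else -1) + (if ε 1 then (1 : ℝ) else -1), -(if ε 0 then (1 : ℝ) else -1) + (if ε 2 then (1 : ℝ) else -1), -(if ε 1 then (1 : ℝ) else -1) - (if ε 2 then (1 : ℝ) else -1)])) 0 = ℓ) :
    ∃ (U : Set (Fin 3 → ℝ)) (H : (Fin 3 → ℝ) → ℂ), IsOpen U ∧ (0 : Fin 3 → ℝ) ∈ U ∧ ContDiffOn ℝ 3 H U ∧
        (∀ θ ∈ U, θ ((P * σ) 0) < θ ((P * σ) 1) ∧ θ ((P * σ) 1) < θ ((P * σ) 2) → H θ = Fz (fun k : Fin 3 => ζ * Circle.exp (θ k))) ∧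
        (1 / 48 : ℂ) * ∑ ε : Fin 3 → Bool, ((((if ε 0 then (1 : ℝ) else -1) * (if ε 1 then (1 : ℝ) else -1) * (if ε 2 then (1 : ℝ) else -1) : ℝ)) : ℂ) *
          iteratedDeriv 3 (fun s : ℝ => H (s • ![(if ε 0 then (1 : ℝ) else -1) + (if ε 1 then (1 : ℝ) else -1), -(if ε 0 then (1 : ℝ) else -1) + (if ε 2 then (1 : ℝ) else -1), -(if ε 1 then (1 : ℝ) else -1) - (if ε 2 then (1 : ℝ) else -1)])) 0 = ℓ := by
  obtain ⟨U, H, hUo, h0U, hH, hHF, hval⟩ := h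
  have hcont : Continuous fun θ : Fin 3 → ℝ => θ ∘ ⇑P := continuous_pi fun k => continuous_apply (P k)
  have hlin : ContDiff ℝ 3 fun θ : Fin 3 → ℝ => θ ∘ ⇑P := contDiff_pi.2 fun k => contDiff_apply ℝ ℝ (P k)
  refine ⟨(fun θ : Fin 3 → ℝ => θ ∘ ⇑P) ⁻¹' U, fun θ => -H (θ ∘ ⇑P), hUo.preimage hcont, ?_, ?_, ?_, ?_⟩
  · have hz : ((0 : Fin 3 → ℝ) ∘ ⇑P) = 0 := funext fun _ => rfl
    show (0 : Fin 3 → ℝ) ∘ ⇑P ∈ U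
    rw [hz]
    exact h0U
  · exact (hH.comp hlin.contDiffOn fun θ hθ => hθ).neg
  · intro θ hθU hθC
    have hC' : (θ ∘ ⇑P) (σ 0) < (θ ∘ ⇑P) (σ 1) ∧ (θ ∘ ⇑P) (σ 1) < (θ ∘ ⇑P) (σ 2) := by
      simpa only [comp_apply, Equiv.Perm.mul_apply] using hθC
    show -H (θ ∘ ⇑P) = Fz (fun k : Fin 3 => ζ * Circle.exp (θ k))
    rw [hHF _ hθU hC', hanti θ (injective_of_mem_chamber hθC), neg_neg]
  · have hsum : ∑ ε : Fin 3 → Bool, ((((if ε 0 then (1 : ℝ) else -1) * (if ε 1 then (1 : ℝ) else -1) * (if ε 2 then (1 : ℝ) else -1) : ℝ)) : ℂ) * iteratedDeriv 3 (fun s : ℝ => -H ((s • ![(if ε 0 then (1 : ℝ) else -1) + (if ε 1 then (1 : ℝ) else -1), -(if ε 0 then (1 : ℝ) else -1) + (if ε 2 then (1 : ℝ) else -1), -(if ε 1 then (1 : ℝ) else -1) - (if ε 2 then (1 : ℝ) else -1)]) ∘ ⇑P)) 0 =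
        ∑ ε : Fin 3 → Bool, -(((((if ε 0 then (1 : ℝ) else -1) * (if ε 1 then (1 : ℝ) else -1) * (if ε 2 then (1 : ℝ) else -1) : ℝ)) : ℂ) * iteratedDeriv 3 (fun s : ℝ => H ((s • ![(if ε 0 then (1 : ℝ) else -1) + (if ε 1 then (1 : ℝ) else -1), -(if ε 0 then (1 : ℝ) else -1) + (if ε 2 then (1 : ℝ) else -1), -(if ε 1 then (1 : ℝ) else -1) - (if ε 2 then (1 : ℝ) else -1)]) ∘ ⇑P)) 0) :=
      Finset.sum_congr rfl fun ε _ => by rw [iteratedDeriv_fun_neg, mul_neg]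
    show (1 / 48 : ℂ) * ∑ ε : Fin 3 → Bool, ((((if ε 0 then (1 : ℝ) else -1) * (if ε 1 then (1 : ℝ) else -1) * (if ε 2 then (1 : ℝ) else -1) : ℝ)) : ℂ) * iteratedDeriv 3 (fun s : ℝ => -H ((s • ![(if ε 0 then (1 : ℝ) else -1) + (if ε 1 then (1 : ℝ) else -1), -(if ε 0 then (1 : ℝ) else -1) + (if ε 2 then (1 : ℝ) else -1), -(if ε 1 then (1 : ℝ) else -1) - (if ε 2 then (1 : ℝ) else -1)]) ∘ ⇑P)) 0 = ℓ
    rw [hsum, Finset.sum_neg_distrib, hskew H, neg_neg]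
    exact hval

end Transport

/-! ## §4 The letter's `Fz = ρ′Δ·Φ`: `P`-skewness from `P`-EVENNESS of the orbital function (true for the compact transposition `W_K`) -/

section Letter

/-- **`F = ρ′Δ·Φ` is `(0 1)`-skew when `Φ` is `(0 1)`-even** on the regular angles (`ρ′Δ` skew, §2).  For `Φ` = the orbital function of `U(σ_w diag α)(ℂ)` this is the case `e₀e₁ > 0`
(the compact pair is `{0,1}`; block Weyl element ★ (A2′)). [cite: Rogawski1990, §8.4 p. 126] -/
theorem rhoWeylDelta_mul_skew_swap01_of_even (Φ : (Fin 3 → Circle) → ℂ) (ζ : Circle)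
    (heven : ∀ θ : Fin 3 → ℝ, Injective θ →
      Φ (fun k : Fin 3 => ζ * Circle.exp ((θ ∘ ⇑(Equiv.swap (0 : Fin 3) 1)) k)) = Φ (fun k : Fin 3 => ζ * Circle.exp (θ k)))
    (θ : Fin 3 → ℝ) (hθ : Injective θ) :
    (fun r : Fin 3 → Circle => ((((r 0 : Circle) : ℂ)) * (((r 2 : Circle) : ℂ))⁻¹) * ((1 - (((r 1 : Circle) : ℂ)) * (((r 0 : Circle) : ℂ))⁻¹) * (1 - (((r 2 : Circle) : ℂ)) * (((r 1 : Circle) : ℂ))⁻¹) * (1 - (((r 2 : Circle) : ℂ)) * (((r 0 : Circle) : ℂ))⁻¹)) * Φ r) (fun k : Fin 3 => ζ * Circle.exp ((θ ∘ ⇑(Equiv.swap (0 : Fin 3) 1)) k)) =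
      -(fun r : Fin 3 → Circle => ((((r 0 : Circle) : ℂ)) * (((r 2 : Circle) : ℂ))⁻¹) * ((1 - (((r 1 : Circle) : ℂ)) * (((r 0 : Circle) : ℂ))⁻¹) * (1 - (((r 2 : Circle) : ℂ)) * (((r 1 : Circle) : ℂ))⁻¹) * (1 - (((r 2 : Circle) : ℂ)) * (((r 0 : Circle) : ℂ))⁻¹)) * Φ r) (fun k : Fin 3 => ζ * Circle.exp (θ k)) := by
  have e0 : (θ ∘ ⇑(Equiv.swap (0 : Fin 3) 1)) 0 = θ 1 := rfl
  have e1 : (θ ∘ ⇑(Equiv.swap (0 : Fin 3) 1)) 1 = θ 0 := rfl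
  have e2 : (θ ∘ ⇑(Equiv.swap (0 : Fin 3) 1)) 2 = θ 2 := rfl
  simp only [heven θ hθ]
  rw [e0, e1, e2, rhoWeylDelta_swap01 _ _ _ (Circle.coe_ne_zero _) (Circle.coe_ne_zero _) (Circle.coe_ne_zero _), neg_mul]

/-- **`F = ρ′Δ·Φ` is `(1 2)`-skew when `Φ` is `(1 2)`-even** (compact pair `{1,2}`). [cite: Rogawski1990, §8.4 p. 126] -/
theorem rhoWeylDelta_mul_skew_swap12_of_even (Φ : (Fin 3 → Circle) → ℂ) (ζ : Circle)
    (heven : ∀ θ : Fin 3 → ℝ, Injective θ →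
      Φ (fun k : Fin 3 => ζ * Circle.exp ((θ ∘ ⇑(Equiv.swap (1 : Fin 3) 2)) k)) = Φ (fun k : Fin 3 => ζ * Circle.exp (θ k)))
    (θ : Fin 3 → ℝ) (hθ : Injective θ) :
    (fun r : Fin 3 → Circle => ((((r 0 : Circle) : ℂ)) * (((r 2 : Circle) : ℂ))⁻¹) * ((1 - (((r 1 : Circle) : ℂ)) * (((r 0 : Circle) : ℂ))⁻¹) * (1 - (((r 2 : Circle) : ℂ)) * (((r 1 : Circle) : ℂ))⁻¹) * (1 - (((r 2 : Circle) : ℂ)) * (((r 0 : Circle) : ℂ))⁻¹)) * Φ r) (fun k : Fin 3 => ζ * Circle.exp ((θ ∘ ⇑(Equiv.swap (1 : Fin 3) 2)) k)) =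
      -(fun r : Fin 3 → Circle => ((((r 0 : Circle) : ℂ)) * (((r 2 : Circle) : ℂ))⁻¹) * ((1 - (((r 1 : Circle) : ℂ)) * (((r 0 : Circle) : ℂ))⁻¹) * (1 - (((r 2 : Circle) : ℂ)) * (((r 1 : Circle) : ℂ))⁻¹) * (1 - (((r 2 : Circle) : ℂ)) * (((r 0 : Circle) : ℂ))⁻¹)) * Φ r) (fun k : Fin 3 => ζ * Circle.exp (θ k)) := by
  have e0 : (θ ∘ ⇑(Equiv.swap (1 : Fin 3) 2)) 0 = θ 0 := rfl
  have e1 : (θ ∘ ⇑(Equiv.swap (1 : Fin 3) 2)) 1 = θ 2 := rfl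
  have e2 : (θ ∘ ⇑(Equiv.swap (1 : Fin 3) 2)) 2 = θ 1 := rfl
  simp only [heven θ hθ]
  rw [e0, e1, e2, rhoWeylDelta_swap12 _ _ _ (Circle.coe_ne_zero _) (Circle.coe_ne_zero _) (Circle.coe_ne_zero _), neg_mul]

/-- **`F = ρ′Δ·Φ` is `(0 2)`-skew when `Φ` is `(0 2)`-even** (compact pair `{0,2}`). [cite: Rogawski1990, §8.4 p. 126] -/
theorem rhoWeylDelta_mul_skew_swap02_of_even (Φ : (Fin 3 → Circle) → ℂ) (ζ : Circle)
    (heven : ∀ θ : Fin 3 → ℝ, Injective θ →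
      Φ (fun k : Fin 3 => ζ * Circle.exp ((θ ∘ ⇑(Equiv.swap (0 : Fin 3) 2)) k)) = Φ (fun k : Fin 3 => ζ * Circle.exp (θ k)))
    (θ : Fin 3 → ℝ) (hθ : Injective θ) :
    (fun r : Fin 3 → Circle => ((((r 0 : Circle) : ℂ)) * (((r 2 : Circle) : ℂ))⁻¹) * ((1 - (((r 1 : Circle) : ℂ)) * (((r 0 : Circle) : ℂ))⁻¹) * (1 - (((r 2 : Circle) : ℂ)) * (((r 1 : Circle) : ℂ))⁻¹) * (1 - (((r 2 : Circle) : ℂ)) * (((r 0 : Circle) : ℂ))⁻¹)) * Φ r) (fun k : Fin 3 => ζ * Circle.exp ((θ ∘ ⇑(Equiv.swap (0 : Fin 3) 2)) k)) =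
      -(fun r : Fin 3 → Circle => ((((r 0 : Circle) : ℂ)) * (((r 2 : Circle) : ℂ))⁻¹) * ((1 - (((r 1 : Circle) : ℂ)) * (((r 0 : Circle) : ℂ))⁻¹) * (1 - (((r 2 : Circle) : ℂ)) * (((r 1 : Circle) : ℂ))⁻¹) * (1 - (((r 2 : Circle) : ℂ)) * (((r 0 : Circle) : ℂ))⁻¹)) * Φ r) (fun k : Fin 3 => ζ * Circle.exp (θ k)) := by
  have e0 : (θ ∘ ⇑(Equiv.swap (0 : Fin 3) 2)) 0 = θ 2 := rfl
  have e1 : (θ ∘ ⇑(Equiv.swap (0 : Fin 3) 2)) 1 = θ 1 := rfl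
  have e2 : (θ ∘ ⇑(Equiv.swap (0 : Fin 3) 2)) 2 = θ 0 := rfl
  simp only [heven θ hθ]
  rw [e0, e1, e2, rhoWeylDelta_swap02 _ _ _ (Circle.coe_ne_zero _) (Circle.coe_ne_zero _) (Circle.coe_ne_zero _), neg_mul]

end Letter

/-! ## §5 (ED. 2) `W_K`-EVENNESS OF THE LETTER'S ORBITAL FUNCTION IN THE CHART, and the three assembled `hanti`s -/

section Evenness

open MeasureTheory Measure NumberField NumberField.InfinitePlace Literature.NumberTheory.Automorphic Literature.NumberTheory.Automorphic.UnitaryGroup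
open scoped Matrix MatrixGroups

/-- Sign bookkeeping: if `a_i a_j > 0` then the transposition `(i j)` preserves the sign pattern of `a`. [cite: Rogawski1990, §8.2 p. 122] -/
theorem pos_iff_pos_comp_swap_of_mul_pos {N : ℕ} {a : Fin N → ℝ} {i j : Fin N} (h : 0 < a i * a j) (k : Fin N) :
    0 < a (Equiv.swap i j k) ↔ 0 < a k := by
  have hij : 0 < a i ↔ 0 < a j := by
    rcases mul_pos_iff.1 h with ⟨hi, hj⟩ | ⟨hi, hj⟩
    · exact ⟨fun _ => hj, fun _ => hi⟩
    · exact ⟨fun h' => absurd h' (not_lt.2 hi.le), fun h' => absurd h' (not_lt.2 hj.le)⟩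
  by_cases hki : k = i
  · subst hki; rw [Equiv.swap_apply_left]; exact hij.symm
  · by_cases hkj : k = j
    · subst hkj; rw [Equiv.swap_apply_right]; exact hij
    · rw [Equiv.swap_apply_of_ne_of_ne hki hkj]

variable (L : Type) [Field L] (α : Fin 3 → L) (w : {w : InfinitePlace L // IsComplex w})
  [MeasurableSpace (archLocal L 3 (Matrix.diagonal α) w)] [BorelSpace (archLocal L 3 (Matrix.diagonal α) w)]

/-- **`W_K`-EVENNESS OF THE LETTER'S ORBITAL FUNCTION, IN THE ANGLE CHART**: for a sign-compatible relabelling `P` (`0 < re σ_wα_{Pk} ↔ 0 < re σ_wα_k`; e.g. the compact transposition),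
`∫ Θ ↑↑(g·t(ζe^{i(θ∘P)})·g⁻¹) dν = ∫ Θ ↑↑(g·t(ζe^{iθ})·g⁻¹) dν` for every right-invariant `ν` — `P` is a Weyl move of `G_w = U(σ_w diag α)(ℂ)` (★ `integral_comp_conj_circleDiagonal_comp_perm`).
The `heven` input of §4. [cite: Rogawski1990, §8.2 p. 122; §8.4 p. 126] -/
theorem integral_comp_conj_circleDiagonal_angleChart_comp_perm (hα : ∀ i, α i ≠ 0) (hreal : ∀ i, (w.1.embedding (α i)).im = 0)
    {P : Equiv.Perm (Fin 3)} (hsign : ∀ k, 0 < (w.1.embedding (α (P k))).re ↔ 0 < (w.1.embedding (α k)).re) (ζ : Circle) (θ : Fin 3 → ℝ)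
    (ν : MeasureTheory.Measure (archLocal L 3 (Matrix.diagonal α) w)) [ν.IsMulRightInvariant] (Θ : Matrix (Fin 3) (Fin 3) ℂ → ℂ) :
    (∫ g, Θ (((g * ⟨circleDiagonal 3 (fun k : Fin 3 => ζ * Circle.exp ((θ ∘ ⇑P) k)), circleDiagonal_mem_archLocal_diagonal L 3 α w _⟩ * g⁻¹ : archLocal L 3 (Matrix.diagonal α) w) : GL (Fin 3) ℂ) : Matrix (Fin 3) (Fin 3) ℂ) ∂ν) =
      (∫ g, Θ (((g * ⟨circleDiagonal 3 (fun k : Fin 3 => ζ * Circle.exp (θ k)), circleDiagonal_mem_archLocal_diagonal L 3 α w _⟩ * g⁻¹ : archLocal L 3 (Matrix.diagonal α) w) : GL (Fin 3) ℂ) : Matrix (Fin 3) (Fin 3) ℂ) ∂ν) :=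
  integral_comp_conj_circleDiagonal_comp_perm L 3 α w hα hreal hsign (fun k : Fin 3 => ζ * Circle.exp (θ k)) ν
    (fun x : archLocal L 3 (Matrix.diagonal α) w => Θ ((x : GL (Fin 3) ℂ) : Matrix (Fin 3) (Fin 3) ℂ))

/-- **THE LETTER'S `F_Θ = ρ′Δ·Φ_Θ` IS `W_K`-SKEW, compact pair `{0,1}`** (`0 < re σ_wα_0 · re σ_wα_1`): for every right-invariant `ν`, every `Θ`, `ζ` and EVERY angle `θ` (regular or not),
`F_Θ(ζe^{i(θ∘(0 1))}) = −F_Θ(ζe^{iθ})` in the letter's exact tokens — the `hanti` input of ★ `exists_chamberExtension_comp_perm` with `P = swap 0 1`, DISCHARGED as `fun θ _ => …` (§2 skewness of `ρ′Δ` + `W_K`-evenness above).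
[cite: Rogawski1990, §8.4 p. 126; §8.2 p. 122] -/
theorem letterIntegrand_skew_swap01_of_compact (hα : ∀ i, α i ≠ 0) (hreal : ∀ i, (w.1.embedding (α i)).im = 0)
    (hcpt : 0 < (w.1.embedding (α 0)).re * (w.1.embedding (α 1)).re)
    (ν : MeasureTheory.Measure (archLocal L 3 (Matrix.diagonal α) w)) [ν.IsMulRightInvariant] (Θ : Matrix (Fin 3) (Fin 3) ℂ → ℂ) (ζ : Circle)
    (θ : Fin 3 → ℝ) :
    (fun r : Fin 3 → Circle => ((((r 0 : Circle) : ℂ)) * (((r 2 : Circle) : ℂ))⁻¹) * ((1 - (((r 1 : Circle) : ℂ)) * (((r 0 : Circle) : ℂ))⁻¹) * (1 - (((r 2 : Circle) : ℂ)) * (((r 1 : Circle) : ℂ))⁻¹) * (1 - (((r 2 : Circle) : ℂ)) * (((r 0 : Circle) : ℂ))⁻¹)) * (∫ g, Θ (((g * ⟨circleDiagonal 3 r, circleDiagonal_mem_archLocal_diagonal L 3 α w _⟩ * g⁻¹ : archLocal L 3 (Matrix.diagonal α) w) : GL (Fin 3) ℂ) : Matrix (Fin 3) (Fin 3) ℂ)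 ∂ν)) (fun k : Fin 3 => ζ * Circle.exp ((θ ∘ ⇑(Equiv.swap (0 : Fin 3) 1)) k)) =
      -(fun r : Fin 3 → Circle => ((((r 0 : Circle) : ℂ)) * (((r 2 : Circle) : ℂ))⁻¹) * ((1 - (((r 1 : Circle) : ℂ)) * (((r 0 : Circle) : ℂ))⁻¹) * (1 - (((r 2 : Circle) : ℂ)) * (((r 1 : Circle) : ℂ))⁻¹) * (1 - (((r 2 : Circle) : ℂ)) * (((r 0 : Circle) : ℂ))⁻¹)) * (∫ g, Θ (((g * ⟨circleDiagonal 3 r, circleDiagonal_mem_archLocal_diagonal L 3 α w _⟩ * g⁻¹ : archLocal L 3 (Matrix.diagonal α) w) : GL (Fin 3) ℂ) : Matrix (Fin 3) (Fin 3) ℂ) ∂ν)) (fun k : Fin 3 => ζ * Circle.exp (θ k)) := by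
  have heven : (∫ g, Θ (((g * ⟨circleDiagonal 3 (fun k : Fin 3 => ζ * Circle.exp ((θ ∘ ⇑(Equiv.swap (0 : Fin 3) 1)) k)), circleDiagonal_mem_archLocal_diagonal L 3 α w _⟩ * g⁻¹ : archLocal L 3 (Matrix.diagonal α) w) : GL (Fin 3) ℂ) : Matrix (Fin 3) (Fin 3) ℂ) ∂ν) =
      (∫ g, Θ (((g * ⟨circleDiagonal 3 (fun k : Fin 3 => ζ * Circle.exp (θ k)), circleDiagonal_mem_archLocal_diagonal L 3 α w _⟩ * g⁻¹ : archLocal L 3 (Matrix.diagonal α) w) : GL (Fin 3) ℂ) : Matrix (Fin 3) (Fin 3) ℂ) ∂ν) :=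
    integral_comp_conj_circleDiagonal_angleChart_comp_perm L α w hα hreal (P := Equiv.swap (0 : Fin 3) 1)
      (pos_iff_pos_comp_swap_of_mul_pos (a := fun k : Fin 3 => (w.1.embedding (α k)).re) (i := 0) (j := 1) hcpt) ζ θ ν Θ
  have e0 : (θ ∘ ⇑(Equiv.swap (0 : Fin 3) 1)) 0 = θ 1 := rfl
  have e1 : (θ ∘ ⇑(Equiv.swap (0 : Fin 3) 1)) 1 = θ 0 := rfl
  have e2 : (θ ∘ ⇑(Equiv.swap (0 : Fin 3) 1)) 2 = θ 2 := rfl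
  beta_reduce
  rw [heven, e0, e1, e2, rhoWeylDelta_swap01 _ _ _ (Circle.coe_ne_zero _) (Circle.coe_ne_zero _) (Circle.coe_ne_zero _), neg_mul]

/-- **THE LETTER'S `F_Θ = ρ′Δ·Φ_Θ` IS `W_K`-SKEW, compact pair `{1,2}`** (`0 < re σ_wα_1 · re σ_wα_2`): for every right-invariant `ν`, every `Θ`, `ζ` and EVERY angle `θ` (regular or not),
`F_Θ(ζe^{i(θ∘(1 2))}) = −F_Θ(ζe^{iθ})` in the letter's exact tokens — the `hanti` input of ★ `exists_chamberExtension_comp_perm` with `P = swap 1 2`, DISCHARGED as `fun θ _ => …` (§2 skewness of `ρ′Δ` + `W_K`-evenness above).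
[cite: Rogawski1990, §8.4 p. 126; §8.2 p. 122] -/
theorem letterIntegrand_skew_swap12_of_compact (hα : ∀ i, α i ≠ 0) (hreal : ∀ i, (w.1.embedding (α i)).im = 0)
    (hcpt : 0 < (w.1.embedding (α 1)).re * (w.1.embedding (α 2)).re)
    (ν : MeasureTheory.Measure (archLocal L 3 (Matrix.diagonal α) w)) [ν.IsMulRightInvariant] (Θ : Matrix (Fin 3) (Fin 3) ℂ → ℂ) (ζ : Circle)
    (θ : Fin 3 → ℝ) :
    (fun r : Fin 3 → Circle => ((((r 0 : Circle) : ℂ)) * (((r 2 : Circle) : ℂ))⁻¹) * ((1 - (((r 1 : Circle) : ℂ)) * (((r 0 : Circle) : ℂ))⁻¹) * (1 - (((r 2 : Circle) : ℂ)) * (((r 1 : Circle) : ℂ))⁻¹) * (1 - (((r 2 : Circle) : ℂ)) * (((r 0 : Circle) : ℂ))⁻¹)) * (∫ g, Θ (((g * ⟨circleDiagonal 3 r, circleDiagonal_mem_archLocal_diagonal L 3 α w _⟩ * g⁻¹ : archLocal L 3 (Matrix.diagonal α) w) : GL (Fin 3) ℂ) : Matrix (Fin 3) (Fin 3) ℂ)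 ∂ν)) (fun k : Fin 3 => ζ * Circle.exp ((θ ∘ ⇑(Equiv.swap (1 : Fin 3) 2)) k)) =
      -(fun r : Fin 3 → Circle => ((((r 0 : Circle) : ℂ)) * (((r 2 : Circle) : ℂ))⁻¹) * ((1 - (((r 1 : Circle) : ℂ)) * (((r 0 : Circle) : ℂ))⁻¹) * (1 - (((r 2 : Circle) : ℂ)) * (((r 1 : Circle) : ℂ))⁻¹) * (1 - (((r 2 : Circle) : ℂ)) * (((r 0 : Circle) : ℂ))⁻¹)) * (∫ g, Θ (((g * ⟨circleDiagonal 3 r, circleDiagonal_mem_archLocal_diagonal L 3 α w _⟩ * g⁻¹ : archLocal L 3 (Matrix.diagonal α) w) : GL (Fin 3) ℂ) : Matrix (Fin 3) (Fin 3) ℂ) ∂ν)) (fun k : Fin 3 => ζ * Circle.exp (θ k)) := by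
  have heven : (∫ g, Θ (((g * ⟨circleDiagonal 3 (fun k : Fin 3 => ζ * Circle.exp ((θ ∘ ⇑(Equiv.swap (1 : Fin 3) 2)) k)), circleDiagonal_mem_archLocal_diagonal L 3 α w _⟩ * g⁻¹ : archLocal L 3 (Matrix.diagonal α) w) : GL (Fin 3) ℂ) : Matrix (Fin 3) (Fin 3) ℂ) ∂ν) =
      (∫ g, Θ (((g * ⟨circleDiagonal 3 (fun k : Fin 3 => ζ * Circle.exp (θ k)), circleDiagonal_mem_archLocal_diagonal L 3 α w _⟩ * g⁻¹ : archLocal L 3 (Matrix.diagonal α) w) : GL (Fin 3) ℂ) : Matrix (Fin 3) (Fin 3) ℂ) ∂ν) :=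
    integral_comp_conj_circleDiagonal_angleChart_comp_perm L α w hα hreal (P := Equiv.swap (1 : Fin 3) 2)
      (pos_iff_pos_comp_swap_of_mul_pos (a := fun k : Fin 3 => (w.1.embedding (α k)).re) (i := 1) (j := 2) hcpt) ζ θ ν Θ
  have e0 : (θ ∘ ⇑(Equiv.swap (1 : Fin 3) 2)) 0 = θ 0 := rfl
  have e1 : (θ ∘ ⇑(Equiv.swap (1 : Fin 3) 2)) 1 = θ 2 := rfl
  have e2 : (θ ∘ ⇑(Equiv.swap (1 : Fin 3) 2)) 2 = θ 1 := rfl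
  beta_reduce
  rw [heven, e0, e1, e2, rhoWeylDelta_swap12 _ _ _ (Circle.coe_ne_zero _) (Circle.coe_ne_zero _) (Circle.coe_ne_zero _), neg_mul]

/-- **THE LETTER'S `F_Θ = ρ′Δ·Φ_Θ` IS `W_K`-SKEW, compact pair `{0,2}`** (`0 < re σ_wα_0 · re σ_wα_2`): for every right-invariant `ν`, every `Θ`, `ζ` and EVERY angle `θ` (regular or not),
`F_Θ(ζe^{i(θ∘(0 2))}) = −F_Θ(ζe^{iθ})` in the letter's exact tokens — the `hanti` input of ★ `exists_chamberExtension_comp_perm` with `P = swap 0 2`, DISCHARGED as `fun θ _ => …` (§2 skewness of `ρ′Δ` + `W_K`-evenness above).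
[cite: Rogawski1990, §8.4 p. 126; §8.2 p. 122] -/
theorem letterIntegrand_skew_swap02_of_compact (hα : ∀ i, α i ≠ 0) (hreal : ∀ i, (w.1.embedding (α i)).im = 0)
    (hcpt : 0 < (w.1.embedding (α 0)).re * (w.1.embedding (α 2)).re)
    (ν : MeasureTheory.Measure (archLocal L 3 (Matrix.diagonal α) w)) [ν.IsMulRightInvariant] (Θ : Matrix (Fin 3) (Fin 3) ℂ → ℂ) (ζ : Circle)
    (θ : Fin 3 → ℝ) :
    (fun r : Fin 3 → Circle => ((((r 0 : Circle) : ℂ)) * (((r 2 : Circle) : ℂ))⁻¹) * ((1 - (((r 1 : Circle) : ℂ)) * (((r 0 : Circle) : ℂ))⁻¹) * (1 - (((r 2 : Circle) : ℂ)) * (((r 1 : Circle) : ℂ))⁻¹) * (1 - (((r 2 : Circle) : ℂ)) * (((r 0 : Circle) : ℂ))⁻¹)) * (∫ g, Θ (((g * ⟨circleDiagonal 3 r, circleDiagonal_mem_archLocal_diagonal L 3 α w _⟩ * g⁻¹ : archLocal L 3 (Matrix.diagonal α) w) : GL (Fin 3) ℂ) : Matrix (Fin 3) (Fin 3) ℂ)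 ∂ν)) (fun k : Fin 3 => ζ * Circle.exp ((θ ∘ ⇑(Equiv.swap (0 : Fin 3) 2)) k)) =
      -(fun r : Fin 3 → Circle => ((((r 0 : Circle) : ℂ)) * (((r 2 : Circle) : ℂ))⁻¹) * ((1 - (((r 1 : Circle) : ℂ)) * (((r 0 : Circle) : ℂ))⁻¹) * (1 - (((r 2 : Circle) : ℂ)) * (((r 1 : Circle) : ℂ))⁻¹) * (1 - (((r 2 : Circle) : ℂ)) * (((r 0 : Circle) : ℂ))⁻¹)) * (∫ g, Θ (((g * ⟨circleDiagonal 3 r, circleDiagonal_mem_archLocal_diagonal L 3 α w _⟩ * g⁻¹ : archLocal L 3 (Matrix.diagonal α) w) : GL (Fin 3) ℂ) : Matrix (Fin 3) (Fin 3) ℂ) ∂ν)) (fun k : Fin 3 => ζ * Circle.exp (θ k)) := by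
  have heven : (∫ g, Θ (((g * ⟨circleDiagonal 3 (fun k : Fin 3 => ζ * Circle.exp ((θ ∘ ⇑(Equiv.swap (0 : Fin 3) 2)) k)), circleDiagonal_mem_archLocal_diagonal L 3 α w _⟩ * g⁻¹ : archLocal L 3 (Matrix.diagonal α) w) : GL (Fin 3) ℂ) : Matrix (Fin 3) (Fin 3) ℂ) ∂ν) =
      (∫ g, Θ (((g * ⟨circleDiagonal 3 (fun k : Fin 3 => ζ * Circle.exp (θ k)), circleDiagonal_mem_archLocal_diagonal L 3 α w _⟩ * g⁻¹ : archLocal L 3 (Matrix.diagonal α) w) : GL (Fin 3) ℂ) : Matrix (Fin 3) (Fin 3) ℂ) ∂ν) :=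
    integral_comp_conj_circleDiagonal_angleChart_comp_perm L α w hα hreal (P := Equiv.swap (0 : Fin 3) 2)
      (pos_iff_pos_comp_swap_of_mul_pos (a := fun k : Fin 3 => (w.1.embedding (α k)).re) (i := 0) (j := 2) hcpt) ζ θ ν Θ
  have e0 : (θ ∘ ⇑(Equiv.swap (0 : Fin 3) 2)) 0 = θ 2 := rfl
  have e1 : (θ ∘ ⇑(Equiv.swap (0 : Fin 3) 2)) 1 = θ 1 := rfl
  have e2 : (θ ∘ ⇑(Equiv.swap (0 : Fin 3) 2)) 2 = θ 0 := rfl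
  beta_reduce
  rw [heven, e0, e1, e2, rhoWeylDelta_swap02 _ _ _ (Circle.coe_ne_zero _) (Circle.coe_ne_zero _) (Circle.coe_ne_zero _), neg_mul]

end Evenness

end Literature.NumberTheory.Rogawski1990

end
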